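import Summits.CriticalPhenomena.PercolationContinuityZ3.Theorems.Transplant.KNCells2Scheme
import HarnessLib

/-!
# F8 (generic, lag-1 anchors): the REPLAY INVARIANT of the anchored state for an ARBITRARY history — the root keeps the root anchors, and every
# other determined macro-vertex carries a departure anchor obtained from its arrival anchor by the re-centring rule
# (needed by the chosen-edge form of `KitAt` / `lawful₂` under design (D): p5-g3's interface objection 14:41Z, lead 14:42:13Z)

builds on p205010 (kernel theorem, internal audit signed; external expert review pending) — nothing in this file uses p205010.
Lane `prim-bschramm`, seat `prim-bschramm-p2` (Run layer); helper file (`--supports stmt-CriticalPhenomena-4575`).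

* `Replayed h` — `arr 0 = a₀`, `dep 0 = a₀`, and `∀ x` determined, `x ≠ 0 → ∃ o, dep x = Γ.anchor (arr x) x o`;
* **`replayed`** — it holds for EVERY history (induction on the replay `astOf₂`: a record updates only the chosen target, which was undetermined,
  and the root is never a target); `dep_eq_anchor_of_choice` — for the chosen edge `e` of the replayed state: `e.1 = 0 ∧ (α, β) = (a₀, a₀)` or
  `β = Γ.anchor α e.1 o` for some `o` (with `α = aOf₁ h e`, `β = aOf₂ h e`).
[cite: KozmaNitzan2024, §4 pp. 25–27 (the exploration process)]
-/

noncomputable section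

open MeasureTheory ProbabilityTheory
open scoped ENNReal Classical

namespace Summit.CriticalPhenomena.PercolationContinuityZ3.Theorems

namespace Transplant

namespace KNCells

open Literature.Probability.Percolation Literature.Probability.LatticeModels SimpleGraph GadgetSystem ProbeHistory HSiteScheme Contour

variable {V : Type*} [DecidableEq V]

namespace KSchA

variable {A : Type*} (G : SimpleGraph V) [G.LocallyFinite] (S : KSchA V A)

/-- **The replay invariant** of the anchored state after `h`. [cite: KozmaNitzan2024, §4 pp. 25–27] -/
structure Replayed (h : ProbeHistory V) : Prop where
  /-- the root is occupied -/
  root_occ : (0 : Site 2) ∈ (S.astOf₂ G h).st.occ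
  /-- the root keeps the root arrival anchor -/
  arr_root : (S.astOf₂ G h).arr 0 = S.Γ.a₀
  /-- the root keeps the root departure anchor -/
  dep_root : (S.astOf₂ G h).dep 0 = S.Γ.a₀
  /-- every other determined vertex was re-centred from its arrival anchor -/
  dep_anchor : ∀ x, (S.astOf₂ G h).st.Det x → x ≠ 0 → ∃ o, (S.astOf₂ G h).dep x = S.Γ.anchor ((S.astOf₂ G h).arr x) x o

variable {G S}

/-- The replay invariant in unfolded form, by induction on the history. [folklore] -/
theorem replayed_aux : ∀ h : ProbeHistory V,
    (0 : Site 2) ∈ (S.astOf₂ G h).st.occ ∧ (S.astOf₂ G h).arr 0 = S.Γ.a₀ ∧ (S.astOf₂ G h).dep 0 = S.Γ.a₀ ∧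
      ∀ x, (S.astOf₂ G h).st.Det x → x ≠ 0 → ∃ o, (S.astOf₂ G h).dep x = S.Γ.anchor ((S.astOf₂ G h).arr x) x o
  | [] => by
    refine ⟨Finset.mem_singleton_self _, rfl, rfl, fun x hx hx0 => ?_⟩
    rcases hx with hx | hx
    · exact absurd (Finset.mem_singleton.1 hx) hx0
    · simp [astOf₂_nil, HSiteScheme.HState.start] at hx
  | none :: h => by rw [astOf₂_cons_none]; exact replayed_aux h
  | some r :: h => by
    obtain ⟨ih0, ihA, ihD, ih⟩ := replayed_aux h
    rw [astOf₂_cons_some]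
    cases hc : (S.astOf₂ G h).st.choice with
    | none => exact ⟨ih0, ihA, ihD, ih⟩
    | some e =>
      simp only
      obtain ⟨-, he2⟩ := HSiteScheme.HState.cand_of_choice hc
      have ht0 : tgt e ≠ 0 := fun h0 => he2 (h0 ▸ Or.inl ih0)
      refine ⟨HSiteScheme.HState.occ_subset_update _ _ _ ih0, ?_, ?_, fun x hx hx0 => ?_⟩
      · rw [Function.update_of_ne ht0.symm]; exact ihA
      · rw [Function.update_of_ne ht0.symm]; exact ihD
      · by_cases hxt : x = tgt e
        · subst hxt
          refine ⟨S.seen G h e ((S.astOf₂ G h).arr e.1) r.2, ?_⟩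
          rw [Function.update_self, Function.update_self, depB]
        · rw [Function.update_of_ne hxt, Function.update_of_ne hxt]
          have hx' : (S.astOf₂ G h).st.Det x := ((HSiteScheme.HState.det_update_iff _ _ _).1 hx).resolve_left hxt
          exact ih x hx' hx0

/-- **The replay invariant holds for every history.** [folklore] -/
theorem replayed (h : ProbeHistory V) : S.Replayed G h :=
  let ⟨h0, hA, hD, hX⟩ := replayed_aux (G := G) (S := S) h
  ⟨h0, hA, hD, hX⟩

/-- **For the chosen edge of the replayed state**: the source is the root with the root anchors, or its departure anchor was re-centred from
its arrival anchor. [folklore] -/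
theorem dep_eq_anchor_of_choice {h : ProbeHistory V} {e : Site 2 × MDir} (hc : (S.astOf₂ G h).st.choice = some e) :
    (e.1 = 0 ∧ S.aOf₁ G h e = S.Γ.a₀ ∧ S.aOf₂ G h e = S.Γ.a₀) ∨ ∃ o, S.aOf₂ G h e = S.Γ.anchor (S.aOf₁ G h e) e.1 o := by
  have hR := replayed (G := G) (S := S) h
  by_cases h0 : e.1 = 0
  · exact Or.inl ⟨h0, by rw [aOf₁, h0, hR.arr_root], by rw [aOf₂, h0, hR.dep_root]⟩
  · exact Or.inr (hR.dep_anchor e.1 (Or.inl (HSiteScheme.HState.cand_of_choice hc).1) h0)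

end KSchA

end KNCells

end Transplant

end Summit.CriticalPhenomena.PercolationContinuityZ3.Theorems

end
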